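import Literature.AlgebraicGeometry.Resolution.DiffOpOfFrobeniusLinear
import HarnessLib

/-!
# EGA IV₄ 16.8.8 (c) on generators: the word criterion for the order of a differential operator

Topic `Literature/AlgebraicGeometry/Resolution`; sequel of `DiffOpOfFrobeniusLinear.lean` (budget form of the order
bound) and of `DiffOpAdicCompletion.lean` (`isDiffOpLE_iff_forall_list`: EGA IV₄ 16.8.8 (c) with iterated commutators
against ALL elements). Here the iterated commutators are taken against GENERATORS only:

  Let `A = R[S, x]` (any subset `S ⊆ A`, any family `x : ι → A`) and let `D : A → A` be `R`-linear and commute with the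
  multiplications by the elements of `S`. Then `D` is a differential operator of order `≤ M` iff every word of length
  `M + 1` in the commutator maps `ad_{xᵢ} : D ↦ [D, xᵢ]` kills `D`.

This is the sharp multi-variable form of `isDiffOpLE_of_adMul_pow_apply_eq_zero` (which it implies by pigeonhole): mixed
commutators are allowed, so e.g. an operator killed by all words of total length `q·m + 1` has order `≤ q·m` even when
no single `ad_{xᵢ}^{c}` with small `c` kills it. Typical use (characteristic `p`, `S = ρ^N(A)`): certify the order of an
operator built `ρ^N(A)`-linearly from a `p`-basis (x-Cartier extensions, Frobenius-twisted Hasse–Schmidt operators).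

Proof: induction on `M` — `[D, xᵢ]` satisfies the criterion with `M − 1` (append the letter `i` to the word), and the
Leibniz rule `[D, ab] = [D, a] ∘ b̂ + â ∘ [D, b]` (with EGA IV₄ 16.8.9) extends from the generators `S ∪ {xᵢ}` to `A`.

## References
* A. Grothendieck, J. Dieudonné, ÉGA IV₄, Publ. Math. IHÉS 32 (1967), Prop. 16.8.8 (c), Prop. 16.8.9. [EGAIV4]
-/

namespace Literature.AlgebraicGeometry.Resolution

/-! ### EGA IV₄ 16.8.8 (c) on generators: the word criterion (sharp form of the order bound) -/

section Words

variable (R : Type*) {A : Type*} [CommSemiring R] [CommRing A] [Algebra R A]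

/-- Words act by composition: `(w ++ w′)·D = w·(w′·D)` for products of commutator maps (plumbing).
[cite: EGAIV4, Prop. 16.8.8 (16.8.8.1)] -/
theorem list_prod_map_adMul_append_apply {ι : Type*} (x : ι → A) (w w' : List ι) (D : A →ₗ[R] A) :
    ((w ++ w').map fun i => adMul R (x i)).prod D =
      (w.map fun i => adMul R (x i)).prod ((w'.map fun i => adMul R (x i)).prod D) := by
  rw [List.map_append, List.prod_append, Module.End.mul_apply]

/-- An operator of order `≤ M` is killed by every word of length `M + 1` in the commutator maps `ad_a`
(EGA IV₄ 16.8.8 (c), necessity; here for arbitrary elements `x i`). [cite: EGAIV4, Prop. 16.8.8 (c)] -/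
theorem IsDiffOpLE.list_prod_map_adMul_apply_eq_zero {ι : Type*} (x : ι → A) :
    ∀ (M : ℕ) {D : A →ₗ[R] A}, IsDiffOpLE R M D →
      ∀ w : List ι, w.length = M + 1 → (w.map fun i => adMul R (x i)).prod D = 0 := by
  -- words act from the inside: induct on the word, lowering the order one commutator at a time
  suffices h : ∀ (w : List ι) (M : ℕ) {D : A →ₗ[R] A}, IsDiffOpLE R M D → w.length = M + 1 →
      (w.map fun i => adMul R (x i)).prod D = 0 from fun M D hD w hw => h w M hD hw
  intro w
  induction w using List.reverseRecOn with
  | nil => intro M D _ hw; simp at hw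
  | append_singleton w i ih =>
    intro M D hD hw
    rw [list_prod_map_adMul_append_apply, List.map_singleton, List.prod_singleton]
    change (w.map fun i => adMul R (x i)).prod (commMul R D (x i)) = 0
    rw [List.length_append, List.length_singleton] at hw
    cases M with
    | zero =>
      have hw0 : w = [] := List.eq_nil_of_length_eq_zero (by omega)
      subst hw0
      simpa using hD (x i)
    | succ M => exact ih M (hD (x i)) (by omega)

/-- **EGA IV₄ 16.8.8 (c) on generators — the word criterion.** Let `A = R[S, x]` (any subset `S`, any family `x`). If
`D` commutes with the multiplications by the elements of `S` and EVERY word of length `M + 1` in the commutator maps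
`ad_{xᵢ}` kills `D` — `ad_{x_{i₀}}(ad_{x_{i₁}}(⋯ ad_{x_{i_M}}(D))) = 0` — then `D` is a differential operator of order `≤ M`.
(Sharper than the budget form `isDiffOpLE_of_adMul_pow_apply_eq_zero`, which it implies by pigeonhole; e.g. it certifies
the order `q·|α|` of a Frobenius-twisted Hasse operator from mixed commutators.) Proof: induction on `M`; `[D, xᵢ]` satisfies
the criterion with `M − 1` (append `i` to the word), and the Leibniz rule extends from the generators to `A`.
[cite: EGAIV4, Prop. 16.8.8 (c)] -/
theorem isDiffOpLE_of_forall_list_adMul_apply_eq_zero {S : Set A} {ι : Type*} {x : ι → A}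
    (hgen : Algebra.adjoin R (S ∪ Set.range x) = ⊤) :
    ∀ (M : ℕ) {D : A →ₗ[R] A}, (∀ s ∈ S, commMul R D s = 0) →
      (∀ w : List ι, w.length = M + 1 → (w.map fun i => adMul R (x i)).prod D = 0) → IsDiffOpLE R M D := by
  intro M
  induction M with
  | zero =>
    intro D hS hw
    refine isDiffOpLE_zero_of_commMul_eq_zero_of_adjoin R hgen fun g hg => ?_
    rcases hg with hg | ⟨i, rfl⟩
    · exact hS g hg
    · simpa using hw [i] rfl
  | succ M ih =>
    intro D hS hw
    -- each `[D, xᵢ]` satisfies the criterion with `M`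
    have hx : ∀ i, IsDiffOpLE R M (commMul R D (x i)) := by
      intro i
      refine ih (fun s hs => ?_) fun w hw' => ?_
      · have := commMul_adMul_pow_apply_eq_zero R (hS s hs) (x i) 1
        rw [pow_one] at this
        exact this
      · have h := hw (w ++ [i]) (by rw [List.length_append, List.length_singleton, hw'])
        rw [list_prod_map_adMul_append_apply, List.map_singleton, List.prod_singleton] at h
        exact h
    -- Leibniz over `A = R[S, x]`
    intro a
    have ha : a ∈ Algebra.adjoin R (S ∪ Set.range x) := by rw [hgen]; exact Algebra.mem_top
    refine Algebra.adjoin_induction (p := fun b _ => IsDiffOpLE R M (commMul R D b)) ?_ ?_ ?_ ?_ ha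
    · rintro g (hg | ⟨i, rfl⟩)
      · rw [hS g hg]; exact IsDiffOpLE.zero M
      · exact hx i
    · intro r; rw [commMul_algebraMap]; exact IsDiffOpLE.zero M
    · intro b b' _ _ hb hb'; rw [commMul_add_right]; exact hb.add hb'
    · intro b b' _ _ hb hb'
      rw [commMul_mul_right]
      have h1 : IsDiffOpLE R M (commMul R D b ∘ₗ LinearMap.mulLeft R b') := by
        simpa using hb.comp (isDiffOpLE_mulLeft (R := R) b')
      have h2 : IsDiffOpLE R M (LinearMap.mulLeft R b ∘ₗ commMul R D b') := by
        simpa using (isDiffOpLE_mulLeft (R := R) b).comp hb'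
      exact h1.add h2

/-- The word criterion as an `iff` for operators commuting with `S`, `A = R[S, x]`: order `≤ M` iff all words of
length `M + 1` in the `ad_{xᵢ}` kill `D`. [cite: EGAIV4, Prop. 16.8.8 (c)] -/
theorem isDiffOpLE_iff_forall_list_adMul_apply_eq_zero {S : Set A} {ι : Type*} {x : ι → A}
    (hgen : Algebra.adjoin R (S ∪ Set.range x) = ⊤) {M : ℕ} {D : A →ₗ[R] A}
    (hS : ∀ s ∈ S, commMul R D s = 0) :
    IsDiffOpLE R M D ↔ ∀ w : List ι, w.length = M + 1 → (w.map fun i => adMul R (x i)).prod D = 0 :=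
  ⟨fun hD => hD.list_prod_map_adMul_apply_eq_zero R x M,
    isDiffOpLE_of_forall_list_adMul_apply_eq_zero R hgen M hS⟩

end Words

end Literature.AlgebraicGeometry.Resolution
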